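import Mathlib
import Summits.Ventures.PercRepro2.SwOutReducible

/-!
# The hull split at a vertex of the region (blind cell PercRepro2, night-4 g32, 2026-08-28;
proofs/NIGHT4-G32.md §1, §5)

For a vertex `p ≠ h` of the region `U`, the side `Q` of a class `(U, ξ)` splits by «`p ∈ hull(h)`».
The configurations with `p` OUTSIDE the hull of `h` are exactly the classes of the smaller region
`U ∖ {p}` for the outside colourings `ξ'` extending `ξ` (`mem_swOutSide_sdiff_iff`); so the rigid
counting inequality on `(U, ξ)` follows from the inequality on every class of `U ∖ {p}` together
with the inequality on the part `{p ∈ hull(h)}` alone (**`rigidOK_of_hullSplit`**).  The census of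
the lane's frontier at `n = 6` (NIGHT4-G32.md §1: the mixed junction `u ~ h` with the neighbour `p`
not joined to `h`) finds both parts true on all 562 pairs while the smaller region is covered by
the theorems of record: the part `{p ∈ hull(h)}` is the precise target left.
-/

namespace Summit.Ventures.PercRepro2

namespace LocRows

open Hull

variable {V : Type*} {E : Type*} [Fintype E] [DecidableEq E]

open scoped Classical

section HullSplit

variable {ends : E → Sym2 V} {U : Set V} {ξ : Config E} {l h o p : V}

omit [Fintype E] [DecidableEq E] in
/-- An edge touching `U ∖ {p}` touches `U`. -/
lemma mem_touches_of_mem_touches_sdiff {e : E} (he : e ∈ touches ends (U \ {p})) :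
    e ∈ touches ends U := by
  obtain ⟨x, hx, y, hxy⟩ := he
  exact ⟨x, hx.1, y, hxy⟩

/-- The outside colouring of `U ∖ {p}` read off a configuration: `ξ` on the edges touching
`U ∖ {p}`, the configuration elsewhere. -/
noncomputable def outerOf (ends : E → Sym2 V) (U : Set V) (p : V) (ξ ζ : Config E) : Config E :=
  fun e => if e ∈ touches ends (U \ {p}) then ξ e else ζ e

omit [Fintype E] [DecidableEq E] in
/-- `outerOf` is `ξ` on the edges touching `U ∖ {p}`. -/
lemma outerOf_of_mem {ζ : Config E} {e : E} (he : e ∈ touches ends (U \ {p})) :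
    outerOf ends U p ξ ζ e = ξ e := by simp only [outerOf, if_pos he]

omit [Fintype E] [DecidableEq E] in
/-- `outerOf` is the configuration on the edges not touching `U ∖ {p}`. -/
lemma outerOf_of_notMem {ζ : Config E} {e : E} (he : e ∉ touches ends (U \ {p})) :
    outerOf ends U p ξ ζ e = ζ e := by simp only [outerOf, if_neg he]

/-- The outside colouring read off a class configuration extends `ξ`. -/
lemma outerOf_agree {ζ : Config E} (hζ : ζ ∈ outClass ends U h ξ) :
    ∀ e, e ∉ touches ends U → outerOf ends U p ξ ζ e = ξ e := by
  intro e he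
  rw [outerOf_of_notMem (fun h' => he (mem_touches_of_mem_touches_sdiff h'))]
  exact (mem_outClass.1 hζ).1 e he

/-- **The configurations of a class with `p` outside the hull of `h` are the classes of
`U ∖ {p}`**: within the side of `(U, ξ)`, `ζ` has `p ∉ hull(h)` and outside colouring
`outerOf ξ ζ₁` iff `ζ` lies in the side of `(U ∖ {p}, outerOf ξ ζ₁)`. -/
theorem mem_swOutSide_sdiff_iff {ζ ζ₁ : Config E} (hζ₁ : ζ₁ ∈ outClass ends U h ξ) :
    (ζ ∈ swOutSide ends l h o U ξ ∧ p ∉ hull ends ζ h ∧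
        outerOf ends U p ξ ζ = outerOf ends U p ξ ζ₁) ↔
      ζ ∈ swOutSide ends l h o (U \ {p}) (outerOf ends U p ξ ζ₁) := by
  rw [mem_swOutSide, mem_swOutSide, mem_outClass, mem_outClass]
  constructor
  · rintro ⟨⟨hQ, hag, hhull⟩, hp, hkey⟩
    refine ⟨hQ, fun e he => ?_, fun x hx => ⟨hhull hx, fun hxp => hp (hxp ▸ hx)⟩⟩
    rw [← hkey, outerOf_of_notMem he]
  · rintro ⟨hQ, hag', hhull'⟩
    have hp : p ∉ hull ends ζ h := fun hp => (hhull' hp).2 rfl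
    refine ⟨⟨hQ, fun e he => ?_, fun x hx => (hhull' hx).1⟩, hp, ?_⟩
    · have he' : e ∉ touches ends (U \ {p}) := fun h' => he (mem_touches_of_mem_touches_sdiff h')
      rw [hag' e he', outerOf_of_notMem he']
      exact (mem_outClass.1 hζ₁).1 e he
    · funext e
      by_cases he : e ∈ touches ends (U \ {p})
      · rw [outerOf_of_mem he, outerOf_of_mem he]
      · rw [outerOf_of_notMem he, hag' e he]

/-- **THE HULL SPLIT**: the rigid counting inequality on the class `(U, ξ)` follows from the
inequality on every class of the smaller region `U ∖ {p}` (for the outside colourings extending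
`ξ`) together with the inequality on the part `{p ∈ hull(h)}` of the side alone (any vertex `p`). -/
theorem rigidOK_of_hullSplit
    (hsub : ∀ ξ' : Config E, (∀ e, e ∉ touches ends U → ξ' e = ξ e) →
      RigidOK ends l h o (U \ {p}) ξ')
    (hin : ∀ 𝓔 : Set (Set E), IsUpperSet 𝓔 →
      ((swOutSide ends l h o U ξ).filter fun ζ =>
          p ∈ hull ends ζ h ∧ redEdges ends ζ h ∈ 𝓔).card ≤
        ((swOutSide ends l h o U ξ).filter fun ζ =>
          p ∈ hull ends ζ h ∧ blueEdges ends ζ h ∈ 𝓔).card) :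
    RigidOK ends l h o U ξ := by
  intro 𝓔 h𝓔
  -- split each side by `p ∈ hull(h)`
  have hsplit : ∀ P : Config E → Prop,
      ((swOutSide ends l h o U ξ).filter fun ζ => P ζ).card =
        ((swOutSide ends l h o U ξ).filter fun ζ => p ∈ hull ends ζ h ∧ P ζ).card +
          ((swOutSide ends l h o U ξ).filter fun ζ => p ∉ hull ends ζ h ∧ P ζ).card := by
    intro P
    rw [← Finset.card_filter_add_card_filter_not (s := (swOutSide ends l h o U ξ).filter
      fun ζ => P ζ) (p := fun ζ => p ∈ hull ends ζ h)]
    simp only [Finset.filter_filter]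
    congr 1 <;> congr 1 <;> ext ζ <;> simp only [and_comm]
  rw [hsplit, hsplit]
  refine Nat.add_le_add (hin 𝓔 h𝓔) ?_
  -- the part outside the hull: the fibres of `outerOf` are the classes of `U ∖ {p}`
  let key : Config E → Config E := outerOf ends U p ξ
  let S₀ : Finset (Config E) := ((swOutSide ends l h o U ξ).filter fun ζ => p ∉ hull ends ζ h).image key
  have hmap : ∀ (P : Config E → Prop) (ζ : Config E),
      ζ ∈ (swOutSide ends l h o U ξ).filter (fun ζ => p ∉ hull ends ζ h ∧ P ζ) → key ζ ∈ S₀ := by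
    intro P ζ hζ
    rw [Finset.mem_filter] at hζ
    exact Finset.mem_image_of_mem key (Finset.mem_filter.2 ⟨hζ.1, hζ.2.1⟩)
  rw [Finset.card_eq_sum_card_fiberwise (hmap _), Finset.card_eq_sum_card_fiberwise (hmap _)]
  refine Finset.sum_le_sum fun k hk => ?_
  obtain ⟨ζ₁, hζ₁, rfl⟩ := Finset.mem_image.1 hk
  have hcl₁ : ζ₁ ∈ outClass ends U h ξ := (mem_swOutSide.1 (Finset.mem_filter.1 hζ₁).1).2
  have hfib : ∀ P : Config E → Prop,
      ((swOutSide ends l h o U ξ).filter (fun ζ => p ∉ hull ends ζ h ∧ P ζ)).filter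
          (fun ζ => key ζ = key ζ₁) =
        (swOutSide ends l h o (U \ {p}) (outerOf ends U p ξ ζ₁)).filter fun ζ => P ζ := by
    intro P
    ext ζ
    simp only [Finset.mem_filter]
    constructor
    · rintro ⟨⟨hζ, hp, hP⟩, hkey⟩
      exact ⟨(mem_swOutSide_sdiff_iff hcl₁).1 ⟨hζ, hp, hkey⟩, hP⟩
    · rintro ⟨hζ, hP⟩
      obtain ⟨hζ', hp, hkey⟩ := (mem_swOutSide_sdiff_iff (l := l) (o := o) hcl₁).2 hζ
      exact ⟨⟨hζ', hp, hP⟩, hkey⟩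
  rw [hfib, hfib]
  exact hsub (outerOf ends U p ξ ζ₁) (outerOf_agree hcl₁) 𝓔 h𝓔

/-- **The hull split as a base of the reduction**: a region is reducible when the smaller region
`U ∖ {p}` is reducible and the part `{p ∈ hull(h)}` of every class satisfies the rigid counting
inequality. -/
theorem reducible_of_hullSplit (hr : Reducible l h o ends (U \ {p}))
    (hin : ∀ (ξ : Config E) (𝓔 : Set (Set E)), IsUpperSet 𝓔 →
      ((swOutSide ends l h o U ξ).filter fun ζ =>
          p ∈ hull ends ζ h ∧ redEdges ends ζ h ∈ 𝓔).card ≤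
        ((swOutSide ends l h o U ξ).filter fun ζ =>
          p ∈ hull ends ζ h ∧ blueEdges ends ζ h ∈ 𝓔).card) :
    Reducible l h o ends U :=
  Reducible.base ends U fun ξ =>
    rigidOK_of_hullSplit (fun ξ' _ => rigidOK_of_reducible l h o hr ξ') (hin ξ)

end HullSplit

end LocRows

end Summit.Ventures.PercRepro2
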